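import Mathlib.Analysis.SpecialFunctions.Integrals.Basic
import Summits.KontsevichZagierPeriods.KontsevichZagierPeriods.Theorems.AbelContractionRealHyperellipticSectorPortDlogMoves
import Summits.KontsevichZagierPeriods.KontsevichZagierPeriods.Theorems.AbelContractionRealHyperellipticSectorPortAlgDlogMoves

/-!
# Route AbelContraction — `RealHyperellipticSector` (crux stmt-KontsevichZagierPeriods-12475):
# the dimension-certified port, layer 2 — multiplicativity of the algebraic dlog carriers

Helper file of the line `Lines/birth.lean` (stub `stub_bakerAlg`, `--supports` the crux): the port
of `Theorems/HurwitzMicroSectorsNormalFormPrincipleCarrierAMulSiegeK8.lean` (namespace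
`…NormalFormPrinciple.PiBox.Dlog.CarrierSiegeK8`) INTO THE BUDGET `KZ.relationsLE 1`:
**multiplicativity of the dlog carriers** `Λ(u, c) := [(1, u), c/y]` with real algebraic data,

  `[Λ(u v, c)] − [Λ(u, c)] − [Λ(v, c)] ∈ KZ.relationsLE 1`   (`1 ≤ u`, `1 ≤ v`, `u, v, c` algebraic),

the KZ-move shadow of `log (u v) = log u + log v` (`carrierA_mul_mem_relationsLE`, registered
sub-goal). Exactly two moves among representations of dimension `1`, through the intermediate
representation `M := [(u, u v), c/y]` (`PiBox.Dlog.exists_dlogA`):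

* rule (1a) + a null point: `[(1, u v)] ≡ [(1, u)] + [(u, u v)]` (`Port.Dlog.split_mem_relationsLE`);
* rule (2), the dilation `y ↦ u y` by the real algebraic factor `u`
  (`Port.Dlog.dlogA_scale_mem_relationsLE`, replacing the private rational-free copy of the
  original file).

Sources: M. Kontsevich, D. Zagier, *Periods* (2001), §1.1, §1.2 rules (1), (2)
[KontsevichZagier2001]. No definitions are introduced.
-/

noncomputable section

open MeasureTheory Set
open Literature.NumberTheory.Transcendental Literature.NumberTheory.Transcendental.KZ
open Literature.ModelTheory.ExponentialFields (IsSemialgebraic)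

namespace Summit.KontsevichZagierPeriods.AbelContraction.RealHyperellipticSector.Port

namespace Dlog

namespace CarrierSiegeK8

open Summit.KontsevichZagierPeriods.HurwitzMicroSectors.NormalFormPrinciple.PiBox.Dlog (exists_dlogA)

/-- **Multiplicativity of the algebraic dlog carriers inside the budget** (registered sub-goal of
crux stmt-KontsevichZagierPeriods-12475, port of `PiBox.Dlog.CarrierSiegeK8.carrierA_mul_mem_relations`):
for any family `R a b c = [(a, b), c/y]` of dlog representations with real algebraic data and real
algebraic `u, v ≥ 1`, `c`, `[R 1 (u v) c] − [R 1 u c] − [R 1 v c] ∈ KZ.relationsLE 1` — split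
`(1, u v)` at `u` (rule 1a in dimension `1`) and rescale `(1, v)` onto `(u, u v)` by `y ↦ u y`
(rule 2 in dimension `1`) (inside the budget `relationsLE 1`).
[cite: KontsevichZagier2001, §1.2 rules (1), (2)] -/
theorem carrierA_mul_mem_relationsLE : ∀ {R : ℝ → ℝ → ℝ → KZ.IntegralRep 1},
    (∀ a b c, IsAlgebraic ℚ a → IsAlgebraic ℚ b → IsAlgebraic ℚ c → 0 < a →
      (R a b c).domain = {x | x 0 ∈ Set.Ioo a b} ∧ (R a b c).integrand = fun x => c / x 0) →
    ∀ {u v c : ℝ}, IsAlgebraic ℚ u → IsAlgebraic ℚ v → IsAlgebraic ℚ c → 1 ≤ u → 1 ≤ v →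
    KZ.of (R 1 (u * v) c) - KZ.of (R 1 u c) - KZ.of (R 1 v c) ∈ KZ.relationsLE 1 := by
  intro R hR u v c hu hv hc hu1 hv1
  have hu0 : (0:ℝ) < u := lt_of_lt_of_le one_pos hu1
  have huv : IsAlgebraic ℚ (u * v) := hu.mul hv
  -- the three carriers, by the defining property of the family `R`
  obtain ⟨hd, hi⟩ := hR 1 (u * v) c isAlgebraic_one huv hc one_pos
  obtain ⟨hdu, hiu⟩ := hR 1 u c isAlgebraic_one hu hc one_pos
  obtain ⟨hdv, hiv⟩ := hR 1 v c isAlgebraic_one hv hc one_pos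
  -- the intermediate representation `M = [(u, u v), c/y]`
  obtain ⟨M, hMd, hMi⟩ := exists_dlogA hu huv hc hu0
  -- rule (1a): split `(1, u v)` at `u` (`1 ≤ u ≤ u v`)
  have hsplit : of (R 1 (u * v) c) - of (R 1 u c) - of M ∈ relationsLE 1 :=
    split_mem_relationsLE (R 1 (u * v) c) (R 1 u c) M hd hdu hMd hu1
      (le_mul_of_one_le_right hu0.le hv1)
      (fun x _ => by rw [hiu, hi]) (fun x _ => by rw [hMi, hi])
  -- rule (2): `[(1, v), c/y] − [(u·1, u·v), c/y] ∈ relationsLE 1`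
  have hscale : of (R 1 v c) - of M ∈ relationsLE 1 :=
    dlogA_scale_mem_relationsLE (a := 1) (b := v) (c := c) (s := u) hu (R 1 v c) M hdv
      (by rw [hMd, mul_one]) (fun x _ => by rw [hiv]) (fun x _ => by rw [hMi]) one_pos hu0
  have heq : of (R 1 (u * v) c) - of (R 1 u c) - of (R 1 v c) =
      (of (R 1 (u * v) c) - of (R 1 u c) - of M) - (of (R 1 v c) - of M) := by abel
  rw [heq]
  exact (relationsLE 1).sub_mem hsplit hscale

end CarrierSiegeK8

end Dlog

end Summit.KontsevichZagierPeriods.AbelContraction.RealHyperellipticSector.Port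

end
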